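/-
Copyright (c) 2026 the pub-hodgecm-mathlib formalisation cell (harness21).  Prover seat hodgecm-mathlib-A-p12 (g27), free A hand plated onto
line LD1 (organ (Gα-C∞) `ArchLadder`, A-p16 (g35)'s plate (P3) «(W0) WRONG TYPE ⇒ 0», LD1-plan (g2) DEALS #10-bis), 2026-09-02.
THEOREMS ONLY (no definition, no named fact, no `sorry`, no instance, no notation).  `--supports stmt-HodgeConjecture-24832 --as helper`.
-/
import Summits.HodgeConjecture.HodgeConjecture.Theorems.F0LD2ThetaTorusEigenclass
import Literature.NumberTheory.Automorphic.IdeleClassCharacterHecke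
import HarnessLib

/-!
# (W0) «WRONG TYPE ⇒ 0»: a Hermite theta class `[Θ̃_{E(h_β ⊗ Φ_f)}(χ) ∘ ιA]` vanishes unless, at every real place `v₀`, the SIGNED place-degree
# of `β` is the one the character `χ` of `[U(⟨a⟩)]` dictates — CENTRE = LINE inside `G₁ = U(V ⊗ W)`, in any rank `N`

Cell hodgecm-mathlib FLOOR 0, programme P6, line LD1 of crux `hLiu418` = `stmt-HodgeConjecture-24832`, organ (Gα-C∞) `ArchLadder` of LD1-plan's
`F0LD1ThetaDichotomyOfBricks` (clause (a) of its intended proof), A-p16 (g35)'s plate (P3).  Namespace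
`Summit.HodgeConjecture.HodgeConjecture.Cruxes.HLiu418.F0LD1ThetaArchLadderWrongType`; binder telescope = ★ `F0LD2ThetaTorusEigenclass` §2.

THE MECHANISM (no `R(k)`, no pin).  For the hermitian LINE `W = ⟨a⟩` the archimedean centre of `U(V)` at a complex place `w₀` and the archimedean
component of `U(W) = U(1)` at `w₀` are THE SAME ELEMENT of the big unitary group `G₁(𝔸) = U(J_V ⊗ J_W)(𝔸)` (★ `UnitaryGroup.adelicPair`):
`(x·1_V at w₀) ⊗ 1 = 1 ⊗ (x at w₀)` (§1 `adelicInl_adelicSingle_eq_adelicInr_adelicSingle`, entrywise through ★ `coe_archToAdelic_apply`, ★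
`coe_archPiEquiv_symm_apply`, ★ `mixedSpace_ext`).  The tree's pair representation is the restriction of ONE splitting of `G₁(𝔸)` along
`(g, h) ↦ (g ⊗ 1)(1 ⊗ h)` (★ `pairSplitting`), so `ω(z_x, 1) = ω(1, h_x)` with NO character comparison (§1 `pairRep_inl_one_eq_one_inr`).  Now
* the `V`-side is ★: `ω(z_x, 1) E(h_β ⊗ Φ_f) = (∏_p x^{n_p(β, v₀)}) • E(h_β ⊗ Φ_f)` (★ T2 `pairRep_chiSplittingLine_adelicSingle_tmul_of_box` + ★
  `carrierConjEquiv_frameD_sectionD_archKPlace_of_diagonal` + ★ `etaD_mul_vac_mul_prod_of_diagonal`, `s = (x, …, x)`), with ★ §2's exponents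
  `n_p(β, v₀) = (τ_{w₀}+1)/2 + β(e₁(p,0), v₀)` on the positive sign class of the frame coordinate `e₁(p,0)` and `(τ_{w₀}+1)/2 − 1 − β(e₁(p,0), v₀)` on the
  negative one ([KonnoKonno2007, Thm. 5.4, Lem. 5.2]);
* the `W`-side is ★ K1: `[Θ̃_{ω(1,h)Φ}(χ) ∘ ιA] = χ([h]) • [Θ̃_Φ(χ) ∘ ιA]` (★ `toLp_lineThetaLift_pairRep_one_charCM`).
Hence §2 **(W0)** `χ([h_x]) • [θ_{h_β ⊗ Φ_f}] = (∏_p x^{n_p(β, v₀)}) • [θ_{h_β ⊗ Φ_f}]` for every `x ∈ S¹`, and §3 **(W0′)**: if `[θ_{h_β ⊗ Φ_f}] ≠ 0` then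
`[θ_{h_β′ ⊗ Φ_f}] = 0` for every `β′` whose SIGNED PLACE-DEGREE `Σ_p ± β′(e₁(p,0), v₀)` (sign = sign class of the coordinate) differs from that of `β` at some
real `v₀` — the `(τ+1)/2` and the vacuum shift `−1` of the negative class are `β`-independent and cancel.  THE ι-WEIGHT CONVENTION (LD-ref1 flag F3): at a
definite place all signs are `+` and the weight is the total place-degree `n₁ + n₂`; at the place of `ι` (signature `(1,1)`) it is `n₁ − n₂`.

HONEST SCOPE.  Nothing of [Liu2021] is asserted; HC_CM is proved only modulo the 7 printed citations (2 remaining: hLiu418 = stmt-HodgeConjecture-24832,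
h413 = stmt-HodgeConjecture-24833) until rung 0 closes; this file books nothing and discharges nothing booked; count-neutral.

## References (prose locators)
* [KonnoKonno2007] K. Konno, T. Konno, Kyushu J. Math. 61 (2007), Thm. 5.4, Lem. 5.2 (K-types of the Weil representation of `U(p,q)`, Fock model).
* [GelbartRogawski1991] S. Gelbart, J. Rogawski, Invent. Math. 105 (1991), §3.1 Prop. 3.1.1 p. 455, §3.2 p. 457 (the pair inside `G₁`, the kernel).
* [Mok2014] C. P. Mok, Mem. AMS 235 (2015), §1 Notation p. 5 (the centre of `U(N)` is `U(1)`).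
* [BorelJacquet1979] A. Borel, H. Jacquet, PSPM 33.1 (1979), §4.1 (`G(𝔸) = G_∞ × G(𝔸_f)`, place components).
* [KashiwaraVergne1978] M. Kashiwara, M. Vergne, Invent. Math. 44 (1978), §6 (harmonic polynomials and `U(1)`-types).
-/

set_option autoImplicit false
set_option linter.dupNamespace false

noncomputable section

open NumberField NumberField.InfinitePlace MeasureTheory IsDedekindDomain
open scoped Matrix ComplexOrder ENNReal TensorProduct SchwartzMap Kronecker Classical ComplexConjugate

namespace Summit.HodgeConjecture.HodgeConjecture.Cruxes.HLiu418.F0LD1ThetaArchLadderWrongType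

open _root_.MeasureTheory
open Literature.NumberTheory.Automorphic Literature.NumberTheory.Automorphic.UnitaryGroup
open Literature.NumberTheory.Automorphic.UnitaryGroup.CotangentForms
open Literature.NumberTheory.Automorphic.IdeleClassGroup
open Literature.NumberTheory.Automorphic.Liu2021
open Literature.NumberTheory.Automorphic.Liu2021.Def411WeilCarriers
open Literature.NumberTheory.Automorphic.Liu2021.Def411WeilCarriersDoubling
open Literature.NumberTheory.Automorphic.Liu2021.CinfThetaTorus
open Literature.NumberTheory.GelbartRogawski1991 Literature.NumberTheory.GelbartRogawski1991.UnitaryDualPair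
open Literature.NumberTheory.GelbartRogawski1991.GRConstruction
open Literature.NumberTheory.Weil1964
open Literature.RepresentationTheory.Liu2021 Literature.RepresentationTheory.CompactGroups
open Literature.RepresentationTheory.HeisenbergGroup Literature.Analysis.SegalBargmann
open Literature.RepresentationTheory.KonnoKonno2007 Literature.RepresentationTheory.KonnoKonno2007.RealDualPair
open Summit.HodgeConjecture.HodgeConjecture.Cruxes.HLiu418.F0LD1ThetaTransportKit
open Summit.HodgeConjecture.HodgeConjecture.Cruxes.HLiu418.F0LD2ThetaTensorClasses
open Summit.HodgeConjecture.HodgeConjecture.Cruxes.HLiu418.F0LD2ThetaTorusEigenclass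

/-! ## §1 CENTRE = LINE inside `G₁ = U(J_V ⊗ J_W)`: `(x·1_N at w₀) ⊗ 1 = 1 ⊗ (x at w₀)`, hence `ω(z_x, 1) = ω(1, h_x)` -/

section CentreLine

variable (L : Type) [Field L] [NumberField L] [IsCMField L] {N : ℕ} (JV : Matrix (Fin N) (Fin N) L) (JW' : Matrix (Fin 1) (Fin 1) L)
  (w₀ : {w : InfinitePlace L // IsComplex w})

set_option maxHeartbeats 800000 in
-- (adelic matrix bookkeeping through `archPiEquiv`)
/-- **CENTRE = LINE in `G₁(𝔸)`**: for a scalar archimedean element `u_V ∈ U(σ_{w₀} J_V)(ℂ)` with matrix `x·1_N` and the archimedean element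
`u_W ∈ U(σ_{w₀} J_W)(ℂ)` of the LINE with (`1 × 1`) matrix `(x)`, the one-place sections satisfy `a(adelicSingle w₀ u_V) = b(adelicSingle w₀ u_W)` in
`G₁(𝔸) = U(J_V ⊗ J_W)(𝔸)` — `(x·1_N, 1 elsewhere; 1_f) ⊗ 1 = 1_N ⊗ (x, 1 elsewhere; 1_f)` entry by entry (★ `coe_archToAdelic_apply`, ★ `coe_archPiEquiv_symm_apply`,
★ `mixedSpace_ext`: a CM field has no real place).  (Mok2014, §1 p. 5) (GelbartRogawski1991, §3.2 p. 457) (BorelJacquet1979, §4.1) -/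
theorem adelicInl_adelicSingle_eq_adelicInr_adelicSingle (x : ℂ)
    (uV : UnitaryGroup.archLocal L N JV w₀) (huV : (((uV : UnitaryGroup.archLocal L N JV w₀) : GL (Fin N) ℂ) : Matrix (Fin N) (Fin N) ℂ) = Matrix.diagonal fun _ => x)
    (uW : UnitaryGroup.archLocal L 1 JW' w₀) (huW : (((uW : UnitaryGroup.archLocal L 1 JW' w₀) : GL (Fin 1) ℂ) : Matrix (Fin 1) (Fin 1) ℂ) = Matrix.diagonal fun _ => x) :
    UnitaryGroup.adelicInl (↥(maximalRealSubfield L)) L (IsCMField.complexConj L) N 1 JV JW'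
        (UnitaryGroup.adelicSingle (↥(maximalRealSubfield L)) L (IsCMField.complexConj L) N JV (IsCMField.complexConj_ne_one L)
          (complexConj_smul_infinitePlace L) w₀ uV) =
      UnitaryGroup.adelicInr (↥(maximalRealSubfield L)) L (IsCMField.complexConj L) N 1 JV JW'
        (UnitaryGroup.adelicSingle (↥(maximalRealSubfield L)) L (IsCMField.complexConj L) 1 JW' (IsCMField.complexConj_ne_one L)
          (complexConj_smul_infinitePlace L) w₀ uW) := by
  -- the archimedean matrices of the two single-place sections, coordinate by coordinate
  have hV : ∀ (i j : Fin N) (w : {w : InfinitePlace L // IsComplex w}),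
      ((((UnitaryGroup.archSingle (↥(maximalRealSubfield L)) L (IsCMField.complexConj L) N JV (IsCMField.complexConj_ne_one L)
          (complexConj_smul_infinitePlace L) w₀ uV : UnitaryGroup.arch (↥(maximalRealSubfield L)) L (IsCMField.complexConj L) N JV) :
          GL (Fin N) (mixedEmbedding.mixedSpace L)) : Matrix (Fin N) (Fin N) (mixedEmbedding.mixedSpace L)) i j).2 w =
        if i = j then (if w = w₀ then x else 1) else 0 := by
    intro i j w
    rw [UnitaryGroup.archSingle_apply, UnitaryGroup.coe_archPiEquiv_symm_apply]
    by_cases hw : w = w₀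
    · subst hw
      rw [Pi.mulSingle_eq_same, huV, if_pos rfl, Matrix.diagonal_apply]
    · rw [Pi.mulSingle_eq_of_ne hw, if_neg hw, OneMemClass.coe_one, Units.val_one, Matrix.one_apply]
  have hW : ∀ (w : {w : InfinitePlace L // IsComplex w}),
      ((((UnitaryGroup.archSingle (↥(maximalRealSubfield L)) L (IsCMField.complexConj L) 1 JW' (IsCMField.complexConj_ne_one L)
          (complexConj_smul_infinitePlace L) w₀ uW : UnitaryGroup.arch (↥(maximalRealSubfield L)) L (IsCMField.complexConj L) 1 JW') :
          GL (Fin 1) (mixedEmbedding.mixedSpace L)) : Matrix (Fin 1) (Fin 1) (mixedEmbedding.mixedSpace L)) 0 0).2 w =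
        if w = w₀ then x else 1 := by
    intro w
    rw [UnitaryGroup.archSingle_apply, UnitaryGroup.coe_archPiEquiv_symm_apply]
    by_cases hw : w = w₀
    · subst hw
      rw [Pi.mulSingle_eq_same, huW, if_pos rfl, Matrix.diagonal_apply_eq]
    · rw [Pi.mulSingle_eq_of_ne hw, if_neg hw, OneMemClass.coe_one, Units.val_one, Matrix.one_apply_eq]
  apply Subtype.ext
  apply Units.ext
  rw [UnitaryGroup.coe_adelicInl, UnitaryGroup.coe_adelicInr]
  ext ⟨i, i'⟩ ⟨j, j'⟩
  obtain rfl : i' = 0 := Subsingleton.elim _ _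
  obtain rfl : j' = 0 := Subsingleton.elim _ _
  rw [Matrix.kroneckerMap_apply, Matrix.kroneckerMap_apply, Matrix.one_apply_eq, mul_one, UnitaryGroup.adelicSingle_apply,
    UnitaryGroup.adelicSingle_apply, UnitaryGroup.coe_archToAdelic_apply, UnitaryGroup.coe_archToAdelic_apply, Matrix.one_apply_eq]
  by_cases hij : i = j
  · subst hij
    rw [Matrix.one_apply_eq, Matrix.one_apply_eq, one_mul]
    congr 2
    exact UnitaryGroup.mixedSpace_ext (↥(maximalRealSubfield L)) L (IsCMField.complexConj L) (IsCMField.complexConj_ne_one L)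
      (complexConj_smul_infinitePlace L) fun w => by rw [hV, hW, if_pos rfl]
  · rw [Matrix.one_apply_ne hij, Matrix.one_apply_ne hij, zero_mul]
    have h0 : (((UnitaryGroup.archSingle (↥(maximalRealSubfield L)) L (IsCMField.complexConj L) N JV (IsCMField.complexConj_ne_one L)
          (complexConj_smul_infinitePlace L) w₀ uV : UnitaryGroup.arch (↥(maximalRealSubfield L)) L (IsCMField.complexConj L) N JV) :
          GL (Fin N) (mixedEmbedding.mixedSpace L)) : Matrix (Fin N) (Fin N) (mixedEmbedding.mixedSpace L)) i j = 0 :=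
      UnitaryGroup.mixedSpace_ext (↥(maximalRealSubfield L)) L (IsCMField.complexConj L) (IsCMField.complexConj_ne_one L)
        (complexConj_smul_infinitePlace L) fun w => by rw [hV, if_neg hij, Prod.snd_zero, Pi.zero_apply]
    rw [h0, map_zero]
    rfl

end CentreLine

section PairRep

variable (F E : Type) [Field F] [NumberField F] [Field E] [NumberField E] [Algebra F E]
variable (c : E ≃ₐ[F] E) (N M : ℕ) {n : ℕ} (e : Fin N × Fin M ≃ Fin n)
variable (JV : Matrix (Fin N) (Fin N) E) (JW : Matrix (Fin M) (Fin M) E)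
variable {TV : Matrix (Fin N) (Fin N) F} {TW : Matrix (Fin M) (Fin M) F}

set_option maxHeartbeats 800000 in
-- (large carrier types)
/-- **`ω(z, 1) = ω(1, h)` whenever `z ⊗ 1 = 1 ⊗ h` in `G₁(𝔸)`**: the tree's pair representation is ONE splitting of `G₁(𝔸)` read along
`(g, h) ↦ (g ⊗ 1)(1 ⊗ h)` (★ `pairSplitting_apply`) — no comparison of splitting characters is involved. (GelbartRogawski1991, §3.1 Prop. 3.1.1 p. 455) -/
theorem pairRep_inl_one_eq_one_inr (s : UnitaryGroup.adelicPair F E c N M JV JW →* adelicMpCont F (Fin n) (adelicGram F e TV TW))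
    {z : UnitaryGroup.adelic F E c N JV} {h : UnitaryGroup.adelic F E c M JW}
    (hzh : UnitaryGroup.adelicInl F E c N M JV JW z = UnitaryGroup.adelicInr F E c N M JV JW h) (Φ : piSchwartzBruhat F (Fin n)) :
    pairRep F E c N M e JV JW s (z, 1) Φ = pairRep F E c N M e JV JW s (1, h) Φ := by
  have h1 : UnitaryGroup.adelicInl F E c N M JV JW z * UnitaryGroup.adelicInr F E c N M JV JW 1 =
      UnitaryGroup.adelicInl F E c N M JV JW 1 * UnitaryGroup.adelicInr F E c N M JV JW h := by
    rw [map_one, map_one, mul_one, one_mul, hzh]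
  show adelicMpCont.omega F (Fin n) (adelicGram F e TV TW) (s (UnitaryGroup.adelicInl F E c N M JV JW z * UnitaryGroup.adelicInr F E c N M JV JW 1)) Φ =
    adelicMpCont.omega F (Fin n) (adelicGram F e TV TW) (s (UnitaryGroup.adelicInl F E c N M JV JW 1 * UnitaryGroup.adelicInr F E c N M JV JW h)) Φ
  rw [h1]

end PairRep

/-! ## §2 (W0): `χ([h_x]) • [θ_{h_β ⊗ Φ_f}] = (∏_p x^{n_p(β, v₀)}) • [θ_{h_β ⊗ Φ_f}]` for every `x ∈ S¹` -/

section WrongType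

variable (L : Type) [Field L] [NumberField L] [IsCMField L] (N : ℕ) (H : Matrix (Fin N) (Fin N) L)
  {n' : ℕ} (e₁ : Fin N × Fin 1 ≃ Fin n') (dV : Fin N → L) (hdV : ∀ i, IsCMField.complexConj L (dV i) = dV i)
  (hdV0 : ∀ i, dV i ≠ 0)
  (ιA : (adelicGroupData (↥(maximalRealSubfield L)) L (IsCMField.complexConj L) N H).Adelic →*
    ↥(UnitaryGroup.adelic (↥(maximalRealSubfield L)) L (IsCMField.complexConj L) N (Matrix.diagonal dV)))
  (hιA : Continuous ιA ∧ ∀ ⦃γ : (adelicGroupData (↥(maximalRealSubfield L)) L (IsCMField.complexConj L) N H).Adelic⦄,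
    γ ∈ (UnitaryGroup.toAdelic (↥(maximalRealSubfield L)) L (IsCMField.complexConj L) N H).range →
      ιA γ ∈ (UnitaryGroup.toAdelic (↥(maximalRealSubfield L)) L (IsCMField.complexConj L) N (Matrix.diagonal dV)).range)
  (μ : Literature.NumberTheory.Automorphic.IdeleClassGroup L →ₜ* Circle) (hμ : IsConjugateSymplectic L μ) (a : (↥(maximalRealSubfield L))ˣ)
  (hρ : HasThetaMajorants fun
      (p : ↥(UnitaryGroup.adelic (↥(maximalRealSubfield L)) L (IsCMField.complexConj L) N (Matrix.diagonal dV)) ×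
        ↥(UnitaryGroup.adelic (↥(maximalRealSubfield L)) L (IsCMField.complexConj L) 1 (JW (↥(maximalRealSubfield L)) L a)))
      (Φ : piSchwartzBruhat (↥(maximalRealSubfield L)) (Fin n')) =>
        pairRep (↥(maximalRealSubfield L)) L (IsCMField.complexConj L) N 1 e₁ (Matrix.diagonal dV) (JW (↥(maximalRealSubfield L)) L a)
          (chiSplittingLine L e₁ dV hdV hdV0 (toHeckeCharacter L μ) (isUnitary_toHeckeCharacter L μ)
            ((isOscillatorChar_toHeckeCharacter_iff μ).mpr hμ) (TW (↥(maximalRealSubfield L)) a)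
            (isUnit_det_TW (↥(maximalRealSubfield L)) a) (JW (↥(maximalRealSubfield L)) L a) (JW_eq (↥(maximalRealSubfield L)) L a))
          p Φ)
  [CompactSpace (↥(UnitaryGroup.adelic (↥(maximalRealSubfield L)) L (IsCMField.complexConj L) N (Matrix.diagonal dV)) ⧸
    (UnitaryGroup.toAdelic (↥(maximalRealSubfield L)) L (IsCMField.complexConj L) N (Matrix.diagonal dV)).range)]
  [MeasurableSpace (↥(UnitaryGroup.adelic (↥(maximalRealSubfield L)) L (IsCMField.complexConj L) 1 (JW (↥(maximalRealSubfield L)) L a)) ⧸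
    (UnitaryGroup.toAdelic (↥(maximalRealSubfield L)) L (IsCMField.complexConj L) 1 (JW (↥(maximalRealSubfield L)) L a)).range)]
  (μW : Measure (↥(UnitaryGroup.adelic (↥(maximalRealSubfield L)) L (IsCMField.complexConj L) 1 (JW (↥(maximalRealSubfield L)) L a)) ⧸
    (UnitaryGroup.toAdelic (↥(maximalRealSubfield L)) L (IsCMField.complexConj L) 1 (JW (↥(maximalRealSubfield L)) L a)).range))
  [BorelSpace (↥(UnitaryGroup.adelic (↥(maximalRealSubfield L)) L (IsCMField.complexConj L) 1 (JW (↥(maximalRealSubfield L)) L a)) ⧸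
    (UnitaryGroup.toAdelic (↥(maximalRealSubfield L)) L (IsCMField.complexConj L) 1 (JW (↥(maximalRealSubfield L)) L a)).range)]
  [IsFiniteMeasure μW]
  [SMulInvariantMeasure ↥(UnitaryGroup.adelic (↥(maximalRealSubfield L)) L (IsCMField.complexConj L) 1 (JW (↥(maximalRealSubfield L)) L a))
    (↥(UnitaryGroup.adelic (↥(maximalRealSubfield L)) L (IsCMField.complexConj L) 1 (JW (↥(maximalRealSubfield L)) L a)) ⧸
      (UnitaryGroup.toAdelic (↥(maximalRealSubfield L)) L (IsCMField.complexConj L) 1 (JW (↥(maximalRealSubfield L)) L a)).range) μW]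
  [CompactSpace (adelicGroupData (↥(maximalRealSubfield L)) L (IsCMField.complexConj L) N H).automorphicQuotient]
  (ν : Measure (adelicGroupData (↥(maximalRealSubfield L)) L (IsCMField.complexConj L) N H).automorphicQuotient) [IsFiniteMeasure ν]

include hιA

set_option maxHeartbeats 1600000 in
-- (the line telescope of ★ T2 is large; the rewrites are few)
/-- **(W0) THE CENTRAL WEIGHT IDENTITY ON A HERMITE THETA CLASS.**  Let `v₀` be a real place of `L⁺`, `w₀ = cmPlaceOver L v₀`, `x ∈ S¹`, `u_V ∈ U(σ_{w₀} diag dV)(ℂ)`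
the scalar `x·1_N` and `u_W ∈ U(σ_{w₀}⟨a⟩)(ℂ)` the scalar `(x)`, `h_x = adelicSingle w₀ u_W ∈ U(⟨a⟩)(𝔸)`, `τ` an odd unitary type of the splitting character, and
`χ` a continuous unitary character of `[U(⟨a⟩)]`.  Then in `L²([U(H)], ν)`
`χ([h_x]) • [Θ̃_{E(h_β ⊗ Φ_f)}(χ) ∘ ιA] = (∏_{p : Fin N} x^{n_p(β, v₀)}) • [Θ̃_{E(h_β ⊗ Φ_f)}(χ) ∘ ιA]`,
`n_p(β, v₀) = (τ_{w₀}+1)/2 + β(e₁(p,0), v₀)` on the positive sign class and `(τ_{w₀}+1)/2 − 1 − β(e₁(p,0), v₀)` on the negative one (§1 centre = line; ★ K1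
`toLp_lineThetaLift_pairRep_one_charCM`; ★ T2 + ★ `carrierConjEquiv_frameD_sectionD_archKPlace_of_diagonal` + ★ `etaD_mul_vac_mul_prod_of_diagonal` at `s = (x, …, x)`).
(KonnoKonno2007, Thm. 5.4, Lem. 5.2) (GelbartRogawski1991, §3.2 p. 457) (Mok2014, §1 p. 5) -/
theorem charCM_smul_thetaClass_follandHermite_eq_prod_zpow_smul (v₀ : {v : InfinitePlace (↥(maximalRealSubfield L)) // v.IsReal})
    {τ : InfinitePlace L → ℤ} (hτ : (toHeckeCharacter L μ).HasUnitaryArchType τ 0) (hodd : ∀ w, Odd (τ w)) (x : Circle)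
    (uV : UnitaryGroup.archLocal L N (Matrix.diagonal dV) (cmPlaceOver L v₀))
    (huV : (((uV : UnitaryGroup.archLocal L N (Matrix.diagonal dV) (cmPlaceOver L v₀)) : GL (Fin N) ℂ) : Matrix (Fin N) (Fin N) ℂ) =
      Matrix.diagonal fun _ => (x : ℂ))
    (uW : UnitaryGroup.archLocal L 1 (JW (↥(maximalRealSubfield L)) L a) (cmPlaceOver L v₀))
    (huW : (((uW : UnitaryGroup.archLocal L 1 (JW (↥(maximalRealSubfield L)) L a) (cmPlaceOver L v₀)) : GL (Fin 1) ℂ) : Matrix (Fin 1) (Fin 1) ℂ) =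
      Matrix.diagonal fun _ => (x : ℂ))
    (χ : haveI := normal_range_toAdelic_JW L a
      PontryaginDual (↥(UnitaryGroup.adelic (↥(maximalRealSubfield L)) L (IsCMField.complexConj L) 1 (JW (↥(maximalRealSubfield L)) L a)) ⧸
        (UnitaryGroup.toAdelic (↥(maximalRealSubfield L)) L (IsCMField.complexConj L) 1 (JW (↥(maximalRealSubfield L)) L a)).range))
    (β : (Fin n' × {v : InfinitePlace (↥(maximalRealSubfield L)) // v.IsReal}) →₀ ℕ) (Φf : FinSB (↥(maximalRealSubfield L)) (Fin n')) :
    haveI := normal_range_toAdelic_JW L a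
    ((χ (QuotientGroup.mk (UnitaryGroup.adelicSingle (↥(maximalRealSubfield L)) L (IsCMField.complexConj L) 1 (JW (↥(maximalRealSubfield L)) L a)
        (IsCMField.complexConj_ne_one L) (complexConj_smul_infinitePlace L) (cmPlaceOver L v₀) uW)) : Circle) : ℂ) •
        MemLp.toLp _ (memLp_toQuotFun_lineThetaLift L N H e₁ dV hdV hdV0 ιA hιA μ hμ a hρ μW
          (piSchwartzBruhatEquiv (↥(maximalRealSubfield L)) (Fin n')
            (follandHermite (frameV L e₁ dV hdV hdV0 (lineW L (TW (Fp L) a)) (complexConj_lineW L (TW (Fp L) a))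
              (lineW_ne_zero L (TW (Fp L) a) (isUnit_det_TW (Fp L) a))) β ⊗ₜ Φf)) (charCM χ) ν 2) =
      (∏ p : Fin N, (x : ℂ) ^ (if 0 < signVec (cmPlaceOver L) (cmGramEntry L e₁ dV hdV (lineW L (TW (Fp L) a)) (complexConj_lineW L (TW (Fp L) a))) (imagUnit L) v₀ (e₁ (p, 0))
        then (τ (cmPlaceOver L v₀).1 + 1) / 2 + β (e₁ (p, 0), v₀)
        else (τ (cmPlaceOver L v₀).1 + 1) / 2 - 1 - β (e₁ (p, 0), v₀))) •
        MemLp.toLp _ (memLp_toQuotFun_lineThetaLift L N H e₁ dV hdV hdV0 ιA hιA μ hμ a hρ μW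
          (piSchwartzBruhatEquiv (↥(maximalRealSubfield L)) (Fin n')
            (follandHermite (frameV L e₁ dV hdV hdV0 (lineW L (TW (Fp L) a)) (complexConj_lineW L (TW (Fp L) a))
              (lineW_ne_zero L (TW (Fp L) a) (isUnit_det_TW (Fp L) a))) β ⊗ₜ Φf)) (charCM χ) ν 2) := by
  haveI := normal_range_toAdelic_JW L a
  set eV := frameV L e₁ dV hdV hdV0 (lineW L (TW (Fp L) a)) (complexConj_lineW L (TW (Fp L) a))
    (lineW_ne_zero L (TW (Fp L) a) (isUnit_det_TW (Fp L) a)) with heV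
  have hx : star (x : ℂ) * (x : ℂ) = 1 := by
    rw [Complex.star_def, ← Complex.normSq_eq_conj_mul_self, Circle.normSq_coe, Complex.ofReal_one]
  -- the `W`-side: `χ`-covariance of the class
  have hWside := toLp_lineThetaLift_pairRep_one_charCM L N H e₁ dV hdV hdV0 ιA hιA μ hμ a hρ μW
    (piSchwartzBruhatEquiv (Fp L) (Fin n') (follandHermite eV β ⊗ₜ Φf)) ν
    (UnitaryGroup.adelicSingle (↥(maximalRealSubfield L)) L (IsCMField.complexConj L) 1 (JW (↥(maximalRealSubfield L)) L a)
      (IsCMField.complexConj_ne_one L) (complexConj_smul_infinitePlace L) (cmPlaceOver L v₀) uW) χ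
  rw [← hWside, ← pairRep_inl_one_eq_one_inr (↥(maximalRealSubfield L)) L (IsCMField.complexConj L) N 1 e₁ (Matrix.diagonal dV)
    (JW (↥(maximalRealSubfield L)) L a) _ (adelicInl_adelicSingle_eq_adelicInr_adelicSingle L (Matrix.diagonal dV) (JW (↥(maximalRealSubfield L)) L a)
      (cmPlaceOver L v₀) (x : ℂ) uV huV uW huW)]
  -- the `V`-side: the scalar central torus acts on `E(h_β ⊗ Φ_f)` by `∏_p x^{n_p}`
  by_cases hΦf : Φf = 0
  · subst hΦf
    rw [TensorProduct.tmul_zero, map_zero, map_zero, ← zero_smul ℂ (0 : piSchwartzBruhat (Fp L) (Fin n')),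
      toLp_lineThetaLift_smul_left L N H e₁ dV hdV hdV0 ιA hιA μ hμ a hρ μW (charCM χ) ν, zero_smul, smul_zero]
  have hne : piSchwartzBruhatEquiv (Fp L) (Fin n') (follandHermite eV 0 ⊗ₜ Φf) ≠ 0 :=
    piSchwartzBruhatEquiv_tmul_ne_zero (gaussianV_ne_zero L e₁ dV hdV hdV0 _ _ _) hΦf
  have hbox := carrierConjEquiv_frameD_sectionD_archKPlace_of_diagonal L e₁ dV hdV hdV0 (lineW L (TW (Fp L) a)) (complexConj_lineW L (TW (Fp L) a))
    (lineW_ne_zero L (TW (Fp L) a) (isUnit_det_TW (Fp L) a)) v₀ uV (fun _ => (x : ℂ)) huV β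
  have hT2 := pairRep_chiSplittingLine_adelicSingle_tmul_of_box L dV hdV hdV0 v₀ e₁ (isUnitary_toHeckeCharacter L μ)
    ((isOscillatorChar_toHeckeCharacter_iff μ).mpr hμ) hτ hodd (TW (Fp L) a) (isUnit_det_TW (Fp L) a) (JW (Fp L) L a) (JW_eq (Fp L) L a) uV hbox Φf hne
  rw [etaD_mul_vac_mul_prod_of_diagonal L e₁ dV hdV hdV0 a v₀ τ uV (fun _ => (x : ℂ)) (fun _ => hx) huV β] at hT2
  rw [toLp_lineThetaLift_congr L N H e₁ dV hdV hdV0 ιA hιA μ hμ a hρ μW (charCM χ) ν hT2,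
    toLp_lineThetaLift_smul_left L N H e₁ dV hdV hdV0 ιA hιA μ hμ a hρ μW (charCM χ) ν]

/-! ## §3 (W0′): a non-zero Hermite class pins the signed place-degrees — «wrong type ⇒ 0» -/

omit hιA in
/-- `∏_i x^{f i} = x^{Σ_i f i}` for `x ≠ 0` (integer exponents). (BorelJacquet1979, §4.1) -/
private theorem prod_zpow_eq_zpow_sum {ι : Type*} (s : Finset ι) {x : ℂ} (hx : x ≠ 0) (f : ι → ℤ) :
    ∏ i ∈ s, x ^ f i = x ^ ∑ i ∈ s, f i := by
  classical
  induction s using Finset.induction_on with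
  | empty => rw [Finset.prod_empty, Finset.sum_empty, zpow_zero]
  | insert a s ha ih => rw [Finset.prod_insert ha, Finset.sum_insert ha, ih, zpow_add₀ hx]

omit hιA in
/-- a point of the circle of which a prescribed non-zero integer power is `−1 ≠ 1`: `x = e^{iπ/Δ}`. (BorelJacquet1979, §4.1) -/
private theorem exists_circle_zpow_ne_one {Δ : ℤ} (hΔ : Δ ≠ 0) : ∃ x : Circle, (x : ℂ) ^ Δ ≠ 1 := by
  refine ⟨Circle.exp (Real.pi / Δ), ?_⟩
  have hΔ' : (Δ : ℂ) ≠ 0 := Int.cast_ne_zero.mpr hΔ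
  rw [Circle.coe_exp, ← Complex.exp_int_mul, show (Δ : ℂ) * ((((Real.pi / Δ : ℝ)) : ℂ) * Complex.I) = Real.pi * Complex.I by
    push_cast; field_simp, Complex.exp_pi_mul_I]
  norm_num

omit [NumberField L] [IsCMField L] hιA in
/-- the scalar `x·1_k`, `x ∈ S¹`, lies in `U(σ_w J)(ℂ)` for every form `J` (★ `scalar_mem_unitaryGroupOfForm`). (Mok2014, §1 p. 5) -/
private theorem scalar_mem_archLocal {k : ℕ} (J : Matrix (Fin k) (Fin k) L) (w : {w : InfinitePlace L // IsComplex w}) (x : Circle) :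
    Units.map (Matrix.scalar (Fin k) : ℂ →+* Matrix (Fin k) (Fin k) ℂ).toMonoidHom (Circle.toUnits x) ∈ UnitaryGroup.archLocal L k J w := by
  rw [UnitaryGroup.mem_archLocal_iff]
  refine mem_unitaryGroupOfForm_iff.mp (scalar_mem_unitaryGroupOfForm (starRingEnd ℂ) _ (Circle.toUnits x) ?_)
  show (starRingEnd ℂ) (x : ℂ) * (x : ℂ) = 1
  rw [← Complex.normSq_eq_conj_mul_self, Circle.normSq_coe, Complex.ofReal_one]

omit hιA in
/-- its matrix is `diag(x, …, x)`. (Mok2014, §1 p. 5) -/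
private theorem coe_scalar_eq_diagonal {k : ℕ} (x : Circle) :
    ((Units.map (Matrix.scalar (Fin k) : ℂ →+* Matrix (Fin k) (Fin k) ℂ).toMonoidHom (Circle.toUnits x) : GL (Fin k) ℂ) : Matrix (Fin k) (Fin k) ℂ) =
      Matrix.diagonal fun _ => (x : ℂ) := by
  show Matrix.scalar (Fin k) ((Circle.toUnits x : ℂˣ) : ℂ) = _
  rw [Matrix.scalar_apply]
  rfl

set_option maxHeartbeats 1600000 in
-- (two instances of (W0) and integer bookkeeping)
/-- **(W0′) «WRONG TYPE ⇒ 0» — the ladder clause, `τ`-free.**  If the Hermite theta class `[Θ̃_{E(h_β ⊗ Φ_f)}(χ) ∘ ιA]` is NON-ZERO, then for every `β′` whose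
SIGNED PLACE-DEGREE `Σ_{p : Fin N} ± β′(e₁(p,0), v₀)` (sign `+` on the positive sign class of the frame coordinate `e₁(p,0)` at `v₀`, `−` on the negative one) differs
from that of `β` at SOME real place `v₀`, the class `[Θ̃_{E(h_β′ ⊗ Φ_f)}(χ) ∘ ιA]` is ZERO.  THE ι-WEIGHT CONVENTION: at a definite `v₀` the signed degree is
the total place-degree (`n₁ + n₂` in rank 2), at the place of `ι` (signature `(1,1)`) it is `n₁ − n₂`.  PROOF: (W0) for `β` and `β′` at every `x ∈ S¹` (the class
being non-zero, `χ([h_x])` equals BOTH `∏_p x^{n_p(β)}` and `∏_p x^{n_p(β′)}`, `τ := hμ.infinityType`); the `β`-independent parts of the exponents cancel, and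
`x = e^{iπ/Δ}`, `Δ` the difference of the signed degrees, gives `−1 = 1`. (KonnoKonno2007, Thm. 5.4) (KashiwaraVergne1978, §6) (GelbartRogawski1991, §3.2 p. 457) -/
theorem thetaClass_follandHermite_eq_zero_of_signedDegree_ne
    (χ : haveI := normal_range_toAdelic_JW L a
      PontryaginDual (↥(UnitaryGroup.adelic (↥(maximalRealSubfield L)) L (IsCMField.complexConj L) 1 (JW (↥(maximalRealSubfield L)) L a)) ⧸
        (UnitaryGroup.toAdelic (↥(maximalRealSubfield L)) L (IsCMField.complexConj L) 1 (JW (↥(maximalRealSubfield L)) L a)).range))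
    (Φf : FinSB (↥(maximalRealSubfield L)) (Fin n')) {β β' : (Fin n' × {v : InfinitePlace (↥(maximalRealSubfield L)) // v.IsReal}) →₀ ℕ}
    (hβ : haveI := normal_range_toAdelic_JW L a
      MemLp.toLp _ (memLp_toQuotFun_lineThetaLift L N H e₁ dV hdV hdV0 ιA hιA μ hμ a hρ μW
          (piSchwartzBruhatEquiv (↥(maximalRealSubfield L)) (Fin n')
            (follandHermite (frameV L e₁ dV hdV hdV0 (lineW L (TW (Fp L) a)) (complexConj_lineW L (TW (Fp L) a))
              (lineW_ne_zero L (TW (Fp L) a) (isUnit_det_TW (Fp L) a))) β ⊗ₜ Φf)) (charCM χ) ν 2) ≠ 0)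
    (v₀ : {v : InfinitePlace (↥(maximalRealSubfield L)) // v.IsReal})
    (hne : (∑ p : Fin N, (if 0 < signVec (cmPlaceOver L) (cmGramEntry L e₁ dV hdV (lineW L (TW (Fp L) a)) (complexConj_lineW L (TW (Fp L) a))) (imagUnit L) v₀ (e₁ (p, 0))
        then (β (e₁ (p, 0), v₀) : ℤ) else -(β (e₁ (p, 0), v₀) : ℤ))) ≠
      ∑ p : Fin N, (if 0 < signVec (cmPlaceOver L) (cmGramEntry L e₁ dV hdV (lineW L (TW (Fp L) a)) (complexConj_lineW L (TW (Fp L) a))) (imagUnit L) v₀ (e₁ (p, 0))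
        then (β' (e₁ (p, 0), v₀) : ℤ) else -(β' (e₁ (p, 0), v₀) : ℤ))) :
    haveI := normal_range_toAdelic_JW L a
    MemLp.toLp _ (memLp_toQuotFun_lineThetaLift L N H e₁ dV hdV hdV0 ιA hιA μ hμ a hρ μW
        (piSchwartzBruhatEquiv (↥(maximalRealSubfield L)) (Fin n')
          (follandHermite (frameV L e₁ dV hdV hdV0 (lineW L (TW (Fp L) a)) (complexConj_lineW L (TW (Fp L) a))
            (lineW_ne_zero L (TW (Fp L) a) (isUnit_det_TW (Fp L) a))) β' ⊗ₜ Φf)) (charCM χ) ν 2) = 0 := by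
  haveI := normal_range_toAdelic_JW L a
  by_contra hβ'
  have hτ : (toHeckeCharacter L μ).HasUnitaryArchType hμ.infinityType 0 :=
    (hasUnitaryArchType_toHeckeCharacter_iff L μ _).2 hμ.hasInfinityType_infinityType
  have hodd : ∀ w, Odd (hμ.infinityType w) := hμ.odd_infinityType
  -- abbreviations for the two exponent families
  set P : Fin N → Prop := fun p => 0 < signVec (cmPlaceOver L) (cmGramEntry L e₁ dV hdV (lineW L (TW (Fp L) a)) (complexConj_lineW L (TW (Fp L) a)))
    (imagUnit L) v₀ (e₁ (p, 0)) with hP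
  set cτ : ℤ := (hμ.infinityType (cmPlaceOver L v₀).1 + 1) / 2 with hcτ
  set nβ : Fin N → ℤ := fun p => if P p then cτ + β (e₁ (p, 0), v₀) else cτ - 1 - β (e₁ (p, 0), v₀) with hnβ
  set nβ' : Fin N → ℤ := fun p => if P p then cτ + β' (e₁ (p, 0), v₀) else cτ - 1 - β' (e₁ (p, 0), v₀) with hnβ'
  -- for every `x ∈ S¹` the two eigenvalues agree (both equal `χ([h_x])`)
  have key : ∀ x : Circle, (∏ p : Fin N, (x : ℂ) ^ nβ p) = ∏ p : Fin N, (x : ℂ) ^ nβ' p := by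
    intro x
    have h1 := charCM_smul_thetaClass_follandHermite_eq_prod_zpow_smul L N H e₁ dV hdV hdV0 ιA hιA μ hμ a hρ μW ν v₀ hτ hodd x
      ⟨_, scalar_mem_archLocal L (Matrix.diagonal dV) (cmPlaceOver L v₀) x⟩ (coe_scalar_eq_diagonal x)
      ⟨_, scalar_mem_archLocal L (JW (↥(maximalRealSubfield L)) L a) (cmPlaceOver L v₀) x⟩ (coe_scalar_eq_diagonal x) χ β Φf
    have h2 := charCM_smul_thetaClass_follandHermite_eq_prod_zpow_smul L N H e₁ dV hdV hdV0 ιA hιA μ hμ a hρ μW ν v₀ hτ hodd x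
      ⟨_, scalar_mem_archLocal L (Matrix.diagonal dV) (cmPlaceOver L v₀) x⟩ (coe_scalar_eq_diagonal x)
      ⟨_, scalar_mem_archLocal L (JW (↥(maximalRealSubfield L)) L a) (cmPlaceOver L v₀) x⟩ (coe_scalar_eq_diagonal x) χ β' Φf
    exact (smul_left_injective ℂ hβ h1).symm.trans (smul_left_injective ℂ hβ' h2)
  -- the `β`-independent parts cancel: `Σ nβ − Σ nβ′ = Δ`
  have hdiff : (∑ p : Fin N, nβ p) - ∑ p : Fin N, nβ' p =
      (∑ p : Fin N, (if P p then (β (e₁ (p, 0), v₀) : ℤ) else -(β (e₁ (p, 0), v₀) : ℤ))) -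
        ∑ p : Fin N, (if P p then (β' (e₁ (p, 0), v₀) : ℤ) else -(β' (e₁ (p, 0), v₀) : ℤ)) := by
    rw [← Finset.sum_sub_distrib, ← Finset.sum_sub_distrib]
    refine Finset.sum_congr rfl fun p _ => ?_
    simp only [hnβ, hnβ']
    split_ifs <;> ring
  have hΔ : (∑ p : Fin N, nβ p) - ∑ p : Fin N, nβ' p ≠ 0 := by
    rw [hdiff]; exact sub_ne_zero.mpr hne
  obtain ⟨x, hx⟩ := exists_circle_zpow_ne_one hΔ
  have hx0 : (x : ℂ) ≠ 0 := Circle.coe_ne_zero x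
  apply hx
  rw [zpow_sub₀ hx0, ← prod_zpow_eq_zpow_sum _ hx0, ← prod_zpow_eq_zpow_sum _ hx0, key x,
    div_self (Finset.prod_ne_zero_iff.mpr fun p _ => zpow_ne_zero _ hx0)]

end WrongType

end Summit.HodgeConjecture.HodgeConjecture.Cruxes.HLiu418.F0LD1ThetaArchLadderWrongType

end
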